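import Literature.Computability.Cryptography.VanDamSeroussiOracle
import Literature.Computability.Cryptography.OrderFindingPostSpec
import HarnessLib

/-!
# The oracle language of the van Dam–Seroussi circuit, II: the shift, kick-back and reconstruction kinds

Topic `Literature/Computability/Cryptography`; sequel of `VanDamSeroussiOracle.lean` (the query
format `encodeQ x tag idx L w₁ regs`, its total parser, and the values `valOf` of the kinds `0–11`)
for the discharge of `VanDamSeroussi2002_gaussSumPhase_qsolvable`. The gadget-free realisation of the
copy replaces the Fourier transform by Kitaev's eigenvalue measurement of the cyclic shift (Kitaev
1995, §5) and imprints the character phases by kick-back on a register in a KNOWN Fourier mode of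
`ℤ/p` (learned by a second eigenvalue measurement); every classical step is again a garbage-free
oracle-XOR of the answer bits of the following ARITHMETIC kinds (all polynomial time — the sequel):

* `12/13` shift / un-shift modulo `p`: `(E + sh) mod p`, `(E' + p − sh mod p) mod p`, where
  `sh = Σ_j y_j 2^{⌊j/2B⌋}` is the power applied by the control string `y = r₁` (block size `B = L`,
  control `j` of level `⌊j/2B⌋`; `VDSOracle.shL`) and `E = val r₂` (Kitaev 1995, §3 Lemma 10);
* `14/15` the same modulo `2^{|r₂|}` (the periodised register);
* `16` the mode index read off the controls: Kitaev's reconstruction with the known modulus `p`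
  (`VDSOracle.uEstL`: block counts of the windows of `r₁`, quadrant numerators `OFPostCF.kq`, the integer
  refinement `OFPostCF.refineNat` of `OrderFindingPostSpec.lean`, then `⌊p·Â/D⌉ mod p`); `17` the same
  with modulus `2^{|r₂|}` followed by Hales's division `k = kOf p 2^{|r₂|} u` (the character argument);
* `18` the kick-back addend `⌊p · frac(e_s d/(p−1))⌉ · u^{p−2} mod p` (`0` if `p ∣ u`) from the branch bit
  `s = head r₁`, the discrete logarithm `d = val (tail r₁)` and the mode index `u = val r₂`
  (`VDSOracle.addend`; van Dam–Seroussi 2002, §3 Lemma 1: the phase `χ(g^d) = ζ_{p−1}^{e d}`);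
* `19/20` addition / subtraction modulo `p` of two registers (moving the mode register on).

`valOf₂` extends `valOf` by these kinds, `specBit₂`/`lang₂` are the answer bit and the language, and the
value lemmas `valOf₂_…` read each kind on a well-formed query. Definitions with bodies; no named fact.

## References

* W. van Dam, G. Seroussi, arXiv:quant-ph/0207131 (2002), §3 Lemma 1, §4 Algorithm 1 [VanDamSeroussi2002].
* A. Yu. Kitaev, arXiv:quant-ph/9511026 (1995), §3 Lemma 10, §5 [Kitaev1995].
* C. H. Bennett, E. Bernstein, G. Brassard, U. Vazirani, SIAM J. Comput. 26 (1997), Cor. 4.15 [BennettBernsteinBrassardVazirani1997].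
-/

noncomputable section

namespace Literature.Computability.Cryptography

namespace VDSOracle

open _root_.Computability Complexity Complexity.Brick Complexity.CodeFP Finset
open Hales2002 (kOf)
open OFPostCF (kq refineNat)

/-! ### The arithmetic of the new kinds -/

/-- **The power applied by a control string** with blocks of size `B`: `Σ_j y_j 2^{⌊j/2B⌋}` (control `j`
has level `⌊j/2B⌋`; a level is a cosine block then a sine block). [cite: Kitaev1995, §3 Lemma 10] -/
def shL (B : ℕ) (y : List Bool) : ℕ := ∑ j ∈ range y.length, (y.getD j false).toNat * 2 ^ (j / (2 * B))

/-- The number of ones in the window `[D, D + B)` of a string. [cite: Kitaev1995, §3 (before Lemma 9)] -/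
def cntL (y : List Bool) (D B : ℕ) : ℕ := ((y.drop D).take B).count true

/-- The number of levels of a control string with blocks of size `B`. [folklore] -/
def lvL (B : ℕ) (y : List Bool) : ℕ := y.length / (2 * B)

/-- The quadrant numerators (over `8`) of the levels. [cite: Kitaev1995, §3 Lemma 10] -/
def kapL (B : ℕ) (y : List Bool) (l : ℕ) : ℕ :=
  if l < lvL B y then kq (decide (2 * cntL y (2 * l * B) B ≤ B)) (decide (2 * cntL y ((2 * l + 1) * B) B ≤ B)) else 0

/-- **The mode index read off a control string** for the modulus `M`: Kitaev's refinement in integers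
`Â = refineNat κ Lv (Lv − 1)` over `D = 8·2^{Lv−1}`, then `⌊M·Â/D⌉ mod M`. [cite: Kitaev1995, §5 with §3 Lemma 10] -/
def uEstL (B M : ℕ) (y : List Bool) : ℕ :=
  (2 * M * refineNat (kapL B y) (lvL B y) (lvL B y - 1) + 8 * 2 ^ (lvL B y - 1)) / (2 * (8 * 2 ^ (lvL B y - 1))) % M

/-- **The kick-back addend**: `⌊p · (e_s d mod (p−1))/(p−1)⌉ · u^{p−2} mod p`, `0` when `p ∣ u`.
[cite: VanDamSeroussi2002, §3 Lemma 1] [cite: Kitaev1995, §5] -/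
def addend (p a : ℕ) (s : Bool) (d u : ℕ) : ℕ :=
  if u % p = 0 then 0
  else (2 * p * (expOf p a s * d % (p - 1)) + (p - 1)) / (2 * (p - 1)) * u ^ (p - 2) % p

/-! ### The extended value table -/

/-- Kind: shift modulo `p`. [folklore] -/
def tagSHIFTP : ℕ := 12
/-- Kind: un-shift modulo `p`. [folklore] -/
def tagUNSHIFTP : ℕ := 13
/-- Kind: shift modulo `2^{|r₂|}`. [folklore] -/
def tagSHIFTQ : ℕ := 14
/-- Kind: un-shift modulo `2^{|r₂|}`. [folklore] -/
def tagUNSHIFTQ : ℕ := 15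
/-- Kind: mode index modulo `p` from the controls. [folklore] -/
def tagRECONP : ℕ := 16
/-- Kind: character argument `k` from the controls of the periodised register. [folklore] -/
def tagRECONK : ℕ := 17
/-- Kind: kick-back addend. [folklore] -/
def tagADDEND : ℕ := 18
/-- Kind: addition modulo `p`. [folklore] -/
def tagMODADDP : ℕ := 19
/-- Kind: subtraction modulo `p`. [folklore] -/
def tagMODSUBP : ℕ := 20

/-- **The values of the new kinds** (`0` below tag `12` and beyond `20`). [cite: VanDamSeroussi2002, §4 Algorithm 1] [cite: Kitaev1995, §3, §5] -/
def newVal (q : Query) : ℕ :=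
  if q.tag = tagSHIFTP then (bitsToNat q.r2 + shL q.L q.r1) % q.p
  else if q.tag = tagUNSHIFTP then (bitsToNat q.r2 + (q.p - shL q.L q.r1 % q.p)) % q.p
  else if q.tag = tagSHIFTQ then (bitsToNat q.r2 + shL q.L q.r1) % 2 ^ q.r2.length
  else if q.tag = tagUNSHIFTQ then (bitsToNat q.r2 + (2 ^ q.r2.length - shL q.L q.r1 % 2 ^ q.r2.length)) % 2 ^ q.r2.length
  else if q.tag = tagRECONP then uEstL q.L q.p q.r1
  else if q.tag = tagRECONK then kOf q.p (2 ^ q.r2.length) (uEstL q.L (2 ^ q.r2.length) q.r1)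
  else if q.tag = tagADDEND then addend q.p q.a (q.r1.headD false) (bitsToNat q.r1.tail) (bitsToNat q.r2)
  else if q.tag = tagMODADDP then (bitsToNat q.r1 + bitsToNat q.r2) % q.p
  else if q.tag = tagMODSUBP then (bitsToNat q.r1 + (q.p - bitsToNat q.r2 % q.p)) % q.p
  else 0

/-- **The extended value table**: kinds `0–11` as `valOf`, kinds `12–20` as `newVal`. [cite: VanDamSeroussi2002, §4 Algorithm 1] -/
def valOf₂ (q : Query) : ℕ := if 12 ≤ q.tag then newVal q else valOf q

/-- **The answer bit** of the extended language. [folklore] -/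
def specBit₂ (q : Query) : Bool :=
  if q.tag = tagFACT then (factCode q.p).getD q.idx false else (valOf₂ q).testBit q.idx

/-- **The extended oracle language of the van Dam–Seroussi circuit.** [cite: BennettBernsteinBrassardVazirani1997, Cor. 4.15] -/
def lang₂ : Language Bool := {w | specBit₂ (parse w) = true}

/-- Membership in the extended language is the answer bit. [folklore] -/
theorem mem_lang₂_iff (w : List Bool) : w ∈ lang₂ ↔ specBit₂ (parse w) = true := Iff.rfl

/-- The indicator of the extended language is the answer bit. [folklore] -/
theorem boolIndicator_lang₂ (w : List Bool) : Set.boolIndicator lang₂ w = specBit₂ (parse w) := by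
  unfold Set.boolIndicator lang₂
  simp only [Set.mem_setOf_eq]
  by_cases h : specBit₂ (parse w) = true
  · rw [if_pos h, h]
  · rw [if_neg h]
    rw [Bool.not_eq_true] at h
    rw [h]

/-! ### Reading the kinds on well-formed queries -/

/-- Old kinds keep their values. [folklore] -/
theorem valOf₂_of_lt {q : Query} (h : q.tag < 12) : valOf₂ q = valOf q := by
  rw [valOf₂, if_neg (not_le.2 h)]

/-- The old answer bits are unchanged. [folklore] -/
theorem specBit₂_of_lt {q : Query} (h : q.tag < 12) : specBit₂ q = specBit q := by
  rw [specBit₂, specBit, valOf₂_of_lt h]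

/-- The answer bit of a non-factoring query of the extended language. [folklore] -/
theorem specBit₂_parse_encodeQ {tag : ℕ} (h : tag ≠ tagFACT) (p g a b idx L w₁ : ℕ) (regs : List Bool) :
    specBit₂ (parse (encodeQ (xOf p g a b) tag idx L w₁ regs)) = (valOf₂ ⟨p, g, a, b, tag, idx, L, w₁, regs⟩).testBit idx := by
  rw [parse_encodeQ, specBit₂, if_neg h]

/-- A new-kind query built from two registers. [folklore] -/
theorem valOf₂_two {tag : ℕ} (htag : 12 ≤ tag) (p g a b idx L : ℕ) (r r' : List Bool) :
    valOf₂ ⟨p, g, a, b, tag, idx, L, r.length, r ++ r'⟩ = newVal ⟨p, g, a, b, tag, idx, L, r.length, r ++ r'⟩ := by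
  rw [valOf₂, if_pos htag]

/-- Kind `12`: `(E + sh(y)) mod p`. [cite: Kitaev1995, §3 Lemma 10] -/
theorem valOf₂_shiftP (p g a b idx B : ℕ) (y e : List Bool) :
    valOf₂ ⟨p, g, a, b, tagSHIFTP, idx, B, y.length, y ++ e⟩ = (bitsToNat e + shL B y) % p := by
  simp [valOf₂, newVal, Query.r1, Query.r2, tagSHIFTP]
/-- Kind `13`: `(E' + p − sh(y) mod p) mod p`. [cite: Kitaev1995, §3 Lemma 10] -/
theorem valOf₂_unshiftP (p g a b idx B : ℕ) (y e : List Bool) :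
    valOf₂ ⟨p, g, a, b, tagUNSHIFTP, idx, B, y.length, y ++ e⟩ = (bitsToNat e + (p - shL B y % p)) % p := by
  simp [valOf₂, newVal, Query.r1, Query.r2, tagSHIFTP, tagUNSHIFTP]
/-- Kind `14`: `(Z + sh(y)) mod 2^{|Z|}`. [cite: Kitaev1995, §5] -/
theorem valOf₂_shiftQ (p g a b idx B : ℕ) (y z : List Bool) :
    valOf₂ ⟨p, g, a, b, tagSHIFTQ, idx, B, y.length, y ++ z⟩ = (bitsToNat z + shL B y) % 2 ^ z.length := by
  simp [valOf₂, newVal, Query.r1, Query.r2, tagSHIFTP, tagUNSHIFTP, tagSHIFTQ]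
/-- Kind `15`: `(Z' + 2^{|Z'|} − sh(y) mod 2^{|Z'|}) mod 2^{|Z'|}`. [cite: Kitaev1995, §5] -/
theorem valOf₂_unshiftQ (p g a b idx B : ℕ) (y z : List Bool) :
    valOf₂ ⟨p, g, a, b, tagUNSHIFTQ, idx, B, y.length, y ++ z⟩ =
      (bitsToNat z + (2 ^ z.length - shL B y % 2 ^ z.length)) % 2 ^ z.length := by
  simp [valOf₂, newVal, Query.r1, Query.r2, tagSHIFTP, tagUNSHIFTP, tagSHIFTQ, tagUNSHIFTQ]
/-- Kind `16`: the mode index modulo `p` read off the controls. [cite: Kitaev1995, §5] -/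
theorem valOf₂_reconP (p g a b idx B : ℕ) (y e : List Bool) :
    valOf₂ ⟨p, g, a, b, tagRECONP, idx, B, y.length, y ++ e⟩ = uEstL B p y := by
  simp [valOf₂, newVal, Query.r1, tagSHIFTP, tagUNSHIFTP, tagSHIFTQ, tagUNSHIFTQ, tagRECONP]
/-- Kind `17`: the character argument `k = kOf p 2^{|Z'|} u` of the mode read off the controls.
[cite: Kitaev1995, §5] [cite: Hales2002, Ch. 9 §2 Def. 25] -/
theorem valOf₂_reconK (p g a b idx B : ℕ) (y z : List Bool) :
    valOf₂ ⟨p, g, a, b, tagRECONK, idx, B, y.length, y ++ z⟩ = kOf p (2 ^ z.length) (uEstL B (2 ^ z.length) y) := by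
  simp [valOf₂, newVal, Query.r1, Query.r2, tagSHIFTP, tagUNSHIFTP, tagSHIFTQ, tagUNSHIFTQ, tagRECONP, tagRECONK]
/-- Kind `18`: the kick-back addend from the branch bit, the discrete logarithm and the mode index.
[cite: VanDamSeroussi2002, §3 Lemma 1] -/
theorem valOf₂_addend (p g a b idx L : ℕ) (s : Bool) (dbits u : List Bool) :
    valOf₂ ⟨p, g, a, b, tagADDEND, idx, L, (s :: dbits).length, (s :: dbits) ++ u⟩ = addend p a s (bitsToNat dbits) (bitsToNat u) := by
  simp [valOf₂, newVal, Query.r1, Query.r2, tagSHIFTP, tagUNSHIFTP, tagSHIFTQ, tagUNSHIFTQ, tagRECONP, tagRECONK, tagADDEND]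
/-- Kind `19`: addition modulo `p`. [folklore] -/
theorem valOf₂_modAddP (p g a b idx L : ℕ) (r r' : List Bool) :
    valOf₂ ⟨p, g, a, b, tagMODADDP, idx, L, r.length, r ++ r'⟩ = (bitsToNat r + bitsToNat r') % p := by
  simp [valOf₂, newVal, Query.r1, Query.r2, tagSHIFTP, tagUNSHIFTP, tagSHIFTQ, tagUNSHIFTQ, tagRECONP, tagRECONK, tagADDEND, tagMODADDP]
/-- Kind `20`: subtraction modulo `p`. [folklore] -/
theorem valOf₂_modSubP (p g a b idx L : ℕ) (r r' : List Bool) :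
    valOf₂ ⟨p, g, a, b, tagMODSUBP, idx, L, r.length, r ++ r'⟩ = (bitsToNat r + (p - bitsToNat r' % p)) % p := by
  simp [valOf₂, newVal, Query.r1, Query.r2, tagSHIFTP, tagUNSHIFTP, tagSHIFTQ, tagUNSHIFTQ, tagRECONP, tagRECONK, tagADDEND, tagMODADDP, tagMODSUBP]
/-! ### The arithmetic of the kinds -/

/-- **Un-shifting undoes shifting** (values below `p > 0`). [folklore] -/
theorem unshift_shift {p : ℕ} (hp : 0 < p) {E : ℕ} (hE : E < p) (s : ℕ) :
    ((E + s) % p + (p - s % p)) % p = E := by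
  have hs : s % p ≤ p := (Nat.mod_lt s hp).le
  have h1 : ((E + s) % p + (p - s % p)) % p = (E + s + (p - s % p)) % p := by
    rw [Nat.add_mod ((E + s) % p), Nat.mod_mod, ← Nat.add_mod]
  rw [h1]
  have hdm := Nat.div_add_mod s p
  have h2 : E + s + (p - s % p) = E + p * (s / p + 1) := by
    zify [hs] at hdm ⊢
    linarith
  rw [h2, Nat.add_mul_mod_self_left, Nat.mod_eq_of_lt hE]

/-- **Subtracting undoes adding** modulo `p`. [folklore] -/
theorem modSub_modAdd {p : ℕ} (hp : 0 < p) {E : ℕ} (hE : E < p) (B : ℕ) :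
    ((E + B) % p + (p - B % p)) % p = E := unshift_shift hp hE B

/-- **The addend kicks back the rounded phase**: `u · addend ≡ ⌊p·m/(p−1)⌉ (mod p)` for `p` prime and
`p ∤ u`, `m = e_s d mod (p−1)` (Fermat: `u · u^{p−2} = u^{p−1} ≡ 1`). [cite: VanDamSeroussi2002, §3 Lemma 1] [cite: Kitaev1995, §5] -/
theorem mul_addend_mod {p : ℕ} (hp : p.Prime) (a : ℕ) (s : Bool) (d : ℕ) {u : ℕ} (hu : u % p ≠ 0) :
    u * addend p a s d u % p = (2 * p * (expOf p a s * d % (p - 1)) + (p - 1)) / (2 * (p - 1)) % p := by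
  rw [addend, if_neg hu, Nat.mul_mod, Nat.mod_mod, ← Nat.mul_mod]
  set r := (2 * p * (expOf p a s * d % (p - 1)) + (p - 1)) / (2 * (p - 1))
  haveI := Fact.mk hp
  have hu' : (u : ZMod p) ≠ 0 := by
    intro h
    rw [ZMod.natCast_eq_zero_iff] at h
    exact hu (Nat.mod_eq_zero_of_dvd h)
  change u * (r * u ^ (p - 2)) ≡ r [MOD p]
  rw [← ZMod.natCast_eq_natCast_iff]
  push_cast
  have hp2 : p - 2 + 1 = p - 1 := by have := hp.two_le; omega
  calc (u : ZMod p) * (r * (u : ZMod p) ^ (p - 2)) = r * ((u : ZMod p) ^ (p - 2) * u) := by ring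
    _ = r * (u : ZMod p) ^ (p - 1) := by rw [← pow_succ, hp2]
    _ = r := by rw [ZMod.pow_card_sub_one_eq_one hu', mul_one]

end VDSOracle

end Literature.Computability.Cryptography

end
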